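import Mathlib
import Literature.LinearAlgebra.TensorProductIntersections
import Summits.HodgeConjecture.HodgeConjecture.Theorems.HodgeLocusCensusFermatPointCodim

/-!
# Hodge-locus census — the JOIN IDENTITY (J1) reproduces the pair-locus codimension for ALL k (def-free helper of `stmt-HodgeConjecture-16267`)

Cell record `og81/FERMAT-POINT-STRUCTURE-g30.md` §4 (i) (pub-hlocus, lead gen 30) and `HOME/pub-hlocus-ivhs-1/gen30/JOIN/README.md`.
For the two census families of Fermat plane pairs — type `[4,4,2^{k-4}]` in the Fermat quartic (`d = 4`, `k₀ = 4`) and type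
`[4,4,4,2^{k-6}]` in the Fermat cubic (`d = 3`, `k₀ = 6`) — splitting the variables as (4-blocks | common 2-cycles) makes the
monomial model a tensor product `R = R₁ ⊗ R₂` with `om_P = om₁ ⊗ w`, `om_P' = om₁' ⊗ w`, and the tensor lemmas (L2)
(`Literature/LinearAlgebra/TensorProductIntersections`) give the exact JOIN IDENTITY
  (J1)  `c_N(k) = Σ_{a ≤ d} Hpair(a) · [x^{d-a}] (1 + x + ⋯ + x^{d-2})^{k-k₀}`,
where `Hpair(a)` is the degree-`a` codimension of `Ann om₁ ∩ Ann om₁'` in the level-`k₀` ring and `[x^b](1+⋯+x^{d-2})^j` is the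
Hilbert function of the Artinian Gorenstein algebra of a linear cycle (in print: Duque Franco–Villaflor Loyola, arXiv:2312.17222,
Thm 1.1 and Rem 7.1 — the Artinian Gorenstein algebra of a join class is the tensor product of the factors).
The level-`k₀` data were COMPUTED (join_check.py 281f03566de4, two primes each, both agreeing):
  `d = 4`: `Hpair = (1, 6, 17, 30, 37)`;   `d = 3`: `Hpair = (1, 9, 27, 39)`.
THEOREM 1 (ii) of `og81/FERMAT-PAIRS-ALL-DEGREES-g29.md` gives the closed form
  `c_N(k, m, d) = 2·C(k-1+d, d) - C(m+d, d) - [(m+1)(2k-m-1) + 2k(k-1-m)]`, here with `m = k-3` (`d = 4`) / `m = k-4` (`d = 3`).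
This file KERNEL-CHECKS that (J1) with the computed data equals the closed form for EVERY `k ≥ k₀` (the record checked
`k ≤ 12` / `k ≤ 14` numerically): writing `k = k₀ + j`,
  `d = 4`:  `37·c₀ + 30·c₁ + 17·c₂ + 6·c₃ + c₄ = 2·C(j+7,4) - C(j+5,4) - [(j+2)(j+6) + 4(j+4)]`,  `c_b := [x^b](1+x+x²)^j`,
  `d = 3`:  `39·C(j,0) + 27·C(j,1) + 9·C(j,2) + C(j,3) = 2·C(j+8,3) - C(j+5,3) - [(j+3)(j+9) + 6(j+6)]`,
together with the closed forms of the low coefficients of `(1 + X + X²)^j` (`c₀ = 1`, `c₁ = j`, `2c₂ = j(j+1)`, `6c₃ = j(j-1)(j+4)`,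
`24c₄ = j(j-1)(j²+7j-6)`) and of `(1 + X)^j` (binomials).  The excess side (J2) is `e_d(λ*; k) = 1·c₀ = 1` for all `k` (the
4-block part has excess only in degree `d`), recorded as `coeff 0 = 1`.
PART A (abstract, over any field `K`, from the cited tensor lemmas of `Literature/LinearAlgebra/TensorProductIntersections`
[Greub, Multilinear Algebra, Ch. 1 §1.15 (1.4), §1.19 (1.12)]) kernel-checks the MECHANISM in its ungraded form:
  * `finrank_quotient_tensor` / `codim_tensor`: CODIMENSION IS MULTIPLICATIVE, `dim (M ⊗ N)/(U ⊗ N + M ⊗ W) = dim(M/U) · dim(N/W)`;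
  * `inf_of_common_lTensor`: `(U ⊗ N + M ⊗ W) ∩ (U' ⊗ N + M ⊗ W) = (U ∩ U') ⊗ N + M ⊗ W`;
  * `ker_map_inf_ker_map`, `codim_ker_map_inf`: for linear maps `a, a' : M → P`, `c : N → Q`,
    `ker(a ⊗ c) ∩ ker(a' ⊗ c) = (ker a ∩ ker a') ⊗ N + M ⊗ ker c`, of codimension `codim(ker a ∩ ker a') · codim(ker c)`;
  * `mulLeft_tmul`, `codim_annihilator_pair_tmul`: in a tensor product of commutative `K`-algebras `A ⊗ C`,
    `codim (Ann(x ⊗ y) ∩ Ann(x' ⊗ y)) = codim_A (Ann x ∩ Ann x') · dim_K (C / Ann y)` — with `A = R₁` (4-blocks), `C = R₂` (2-cycles),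
    `x = om₁`, `x' = om₁'`, `y = w` this is (J1) summed over all degrees.  The GRADED form (J1) (degree-`d` piece = the convolution above)
    follows by applying the same statements to the homogeneous pieces `(R₁ ⊗ R₂)_t = ⊕_{a+b=t} R₁,a ⊗ R₂,b` of the multigraded
    monomial rings; that bookkeeping, and the computation of `Hpair`, are NOT formalised here (record §4 (i)).
PART B (arithmetic) certifies that the fourth code path's formula agrees with THEOREM 1 (ii) for all `k`, not merely the tabulated ones.

certified instances and evidence bearing on the general Hodge conjecture; no claim.
-/

open Polynomial

namespace Summit.HodgeConjecture.HodgeConjecture.HodgeLocus.Census.JoinIdentity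

open Summit.HodgeConjecture.HodgeConjecture.HodgeLocus.Census.FermatPointCodim
  (two_mul_choose_two six_mul_choose_three twentyfour_mul_choose_four)

/-! ## PART A — the mechanism of (J1), ungraded, over any field (from [Greub1978Multilinear] (1.4), (1.12) as formalised in
`Literature.LinearAlgebra.TensorProductIntersections`) -/

section Abstract

open scoped TensorProduct

variable {K : Type*} [Field K] {M N : Type*} [AddCommGroup M] [Module K M] [AddCommGroup N] [Module K N]

/-- The quotient of `M ⊗ N` by `U ⊗ N + M ⊗ W` is `(M ⧸ U) ⊗ (N ⧸ W)` (right exactness; (1.12) with `φ = π_U`, `ψ = π_W`). -/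
theorem nonempty_quotient_tensor_equiv (U : Submodule K M) (W : Submodule K N) :
    Nonempty ((((M ⊗[K] N) ⧸ (LinearMap.range (U.subtype.rTensor N) ⊔ LinearMap.range (W.subtype.lTensor M))))
      ≃ₗ[K] ((M ⧸ U) ⊗[K] (N ⧸ W))) := by
  have hker : LinearMap.ker (TensorProduct.map U.mkQ W.mkQ)
      = LinearMap.range (U.subtype.rTensor N) ⊔ LinearMap.range (W.subtype.lTensor M) := by
    have h := Literature.LinearAlgebra.ker_map_eq_sup (U.mkQ) (W.mkQ) (N := N) (M := M)
    rw [Submodule.ker_mkQ, Submodule.ker_mkQ] at h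
    exact h
  have hsurj : Function.Surjective (TensorProduct.map U.mkQ W.mkQ) :=
    TensorProduct.map_surjective (Submodule.mkQ_surjective U) (Submodule.mkQ_surjective W)
  exact ⟨(Submodule.quotEquivOfEq _ _ hker.symm).trans (LinearMap.quotKerEquivOfSurjective _ hsurj)⟩

/-- CODIMENSION IS MULTIPLICATIVE: `dim (M ⊗ N)/(U ⊗ N + M ⊗ W) = dim (M/U) · dim (N/W)`. -/
theorem finrank_quotient_tensor (U : Submodule K M) (W : Submodule K N) :
    Module.finrank K ((M ⊗[K] N) ⧸ (LinearMap.range (U.subtype.rTensor N) ⊔ LinearMap.range (W.subtype.lTensor M)))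
      = Module.finrank K (M ⧸ U) * Module.finrank K (N ⧸ W) := by
  obtain ⟨e⟩ := nonempty_quotient_tensor_equiv U W
  rw [e.finrank_eq, Module.finrank_tensorProduct]

/-- Codimension form of `finrank_quotient_tensor`: `dim(M ⊗ N) - dim(U ⊗ N + M ⊗ W) = (dim M - dim U)(dim N - dim W)`. -/
theorem codim_tensor [FiniteDimensional K M] [FiniteDimensional K N] (U : Submodule K M) (W : Submodule K N) :
    Module.finrank K (M ⊗[K] N)
        - Module.finrank K ↥(LinearMap.range (U.subtype.rTensor N) ⊔ LinearMap.range (W.subtype.lTensor M))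
      = (Module.finrank K M - Module.finrank K U) * (Module.finrank K N - Module.finrank K W) := by
  have h1 := Submodule.finrank_quotient_add_finrank
    (LinearMap.range (U.subtype.rTensor N) ⊔ LinearMap.range (W.subtype.lTensor M))
  have h2 := Submodule.finrank_quotient_add_finrank U
  have h3 := Submodule.finrank_quotient_add_finrank W
  have h4 := finrank_quotient_tensor U W
  rw [← h1, ← h2, ← h3, h4]
  simp


/-- The preimage of `V ⊗ (N/W)` under `M ⊗ N → M ⊗ (N/W)` is `V ⊗ N + M ⊗ W`. -/
theorem comap_lTensor_mkQ_range_rTensor (V : Submodule K M) (W : Submodule K N) :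
    Submodule.comap ((W.mkQ).lTensor M) (LinearMap.range (V.subtype.rTensor (N ⧸ W)))
      = LinearMap.range (V.subtype.rTensor N) ⊔ LinearMap.range (W.subtype.lTensor M) := by
  have hker : LinearMap.ker ((W.mkQ).lTensor M) = LinearMap.range (W.subtype.lTensor M) := by
    have h := Literature.LinearAlgebra.ker_lTensor_eq (M := M) W.mkQ
    rw [Submodule.ker_mkQ] at h
    exact h
  have hmap : Submodule.map ((W.mkQ).lTensor M) (LinearMap.range (V.subtype.rTensor N))
      = LinearMap.range (V.subtype.rTensor (N ⧸ W)) := by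
    rw [← LinearMap.range_comp, LinearMap.lTensor_comp_rTensor, ← LinearMap.rTensor_comp_lTensor, LinearMap.range_comp,
      LinearMap.range_eq_top.mpr (LinearMap.lTensor_surjective _ (Submodule.mkQ_surjective W)), Submodule.map_top]
  rw [← hmap, Submodule.comap_map_eq, hker]

/-- Intersection with a common summand: `(U ⊗ N + M ⊗ W) ∩ (U' ⊗ N + M ⊗ W) = (U ∩ U') ⊗ N + M ⊗ W` ((1.4) in `M ⊗ (N/W)`, pulled back). -/
theorem inf_of_common_lTensor (U U' : Submodule K M) (W : Submodule K N) :
    (LinearMap.range (U.subtype.rTensor N) ⊔ LinearMap.range (W.subtype.lTensor M))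
      ⊓ (LinearMap.range (U'.subtype.rTensor N) ⊔ LinearMap.range (W.subtype.lTensor M))
    = LinearMap.range ((U ⊓ U').subtype.rTensor N) ⊔ LinearMap.range (W.subtype.lTensor M) := by
  rw [← comap_lTensor_mkQ_range_rTensor U W, ← comap_lTensor_mkQ_range_rTensor U' W, ← Submodule.comap_inf,
    Literature.LinearAlgebra.range_rTensor_subtype_inf, comap_lTensor_mkQ_range_rTensor]

variable {P Q : Type*} [AddCommGroup P] [Module K P] [AddCommGroup Q] [Module K Q]

/-- `ker(a ⊗ c) ∩ ker(a' ⊗ c) = (ker a ∩ ker a') ⊗ N + M ⊗ ker c` ((1.12) twice, then `inf_of_common_lTensor`). -/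
theorem ker_map_inf_ker_map (a a' : M →ₗ[K] P) (c : N →ₗ[K] Q) :
    LinearMap.ker (TensorProduct.map a c) ⊓ LinearMap.ker (TensorProduct.map a' c)
      = LinearMap.range ((LinearMap.ker a ⊓ LinearMap.ker a').subtype.rTensor N)
          ⊔ LinearMap.range ((LinearMap.ker c).subtype.lTensor M) := by
  rw [Literature.LinearAlgebra.ker_map_eq_sup, Literature.LinearAlgebra.ker_map_eq_sup, inf_of_common_lTensor]

/-- `dim (M ⊗ N)/(ker(a ⊗ c) ∩ ker(a' ⊗ c)) = dim(M/(ker a ∩ ker a')) · dim(N/ker c)`. -/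
theorem finrank_quotient_ker_map_inf (a a' : M →ₗ[K] P) (c : N →ₗ[K] Q) :
    Module.finrank K ((M ⊗[K] N) ⧸ (LinearMap.ker (TensorProduct.map a c) ⊓ LinearMap.ker (TensorProduct.map a' c)))
      = Module.finrank K (M ⧸ (LinearMap.ker a ⊓ LinearMap.ker a')) * Module.finrank K (N ⧸ LinearMap.ker c) := by
  rw [(Submodule.quotEquivOfEq _ _ (ker_map_inf_ker_map a a' c)).finrank_eq, finrank_quotient_tensor]

/-- (J2), UNGRADED: `dim (M ⊗ N)/ker(f ⊗ c) = dim(M/ker f) · dim(N/ker c)` for every `f` (e.g. `f = a + λ a'`, a pencil member); with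
`finrank_quotient_ker_map_inf` this gives the multiplicativity of the EXCESS, `e(f ⊗ c) := dim ker(f ⊗ c) - dim(ker(a ⊗ c) ∩ ker(a' ⊗ c))
= [dim ker f - dim(ker a ∩ ker a')] · dim(N/ker c)` — the census's `e_d(λ; k) = Σ_a e_a^{(k₀)}(λ) · [x^{d-a}](1 + ⋯ + x^{d-2})^{k-k₀}` summed over degrees. -/
theorem finrank_quotient_ker_map (f : M →ₗ[K] P) (c : N →ₗ[K] Q) :
    Module.finrank K ((M ⊗[K] N) ⧸ LinearMap.ker (TensorProduct.map f c))
      = Module.finrank K (M ⧸ LinearMap.ker f) * Module.finrank K (N ⧸ LinearMap.ker c) := by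
  rw [(Submodule.quotEquivOfEq _ _ (Literature.LinearAlgebra.ker_map_eq_sup f c)).finrank_eq, finrank_quotient_tensor]

/-- Codimension form of `finrank_quotient_ker_map_inf`. -/
theorem codim_ker_map_inf [FiniteDimensional K M] [FiniteDimensional K N] (a a' : M →ₗ[K] P) (c : N →ₗ[K] Q) :
    Module.finrank K (M ⊗[K] N)
        - Module.finrank K ↥(LinearMap.ker (TensorProduct.map a c) ⊓ LinearMap.ker (TensorProduct.map a' c))
      = (Module.finrank K M - Module.finrank K ↥(LinearMap.ker a ⊓ LinearMap.ker a'))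
          * (Module.finrank K N - Module.finrank K ↥(LinearMap.ker c)) := by
  rw [ker_map_inf_ker_map, codim_tensor]


/-- Multiplication by a pure tensor in `A ⊗_K C` is the tensor product of the two multiplications. -/
theorem mulLeft_tmul {A C : Type*} [CommRing A] [Algebra K A] [CommRing C] [Algebra K C] (x : A) (y : C) :
    LinearMap.mulLeft K (x ⊗ₜ[K] y) = TensorProduct.map (LinearMap.mulLeft K x) (LinearMap.mulLeft K y) := by
  apply TensorProduct.ext'
  intro m n
  simp [Algebra.TensorProduct.tmul_mul_tmul]

/-- (J1), UNGRADED: in a tensor product `A ⊗_K C` of finite-dimensional commutative `K`-algebras, the codimension of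
`Ann(x ⊗ y) ∩ Ann(x' ⊗ y)` equals `codim_A(Ann x ∩ Ann x') · dim_K(C / Ann y)`.  Census dictionary: `A = R₁` (the 4-blocks),
`C = R₂` (the common 2-cycles), `x = om₁`, `x' = om₁'` (class elements of the two 4-block parts), `y = w` (class element of the
2-cycles), `Ann(om_P) ∩ Ann(om_P') = T_P ∩ T_P'` (the tangent spaces mod `J(F)`), so the left side summed over degrees is `Σ_t codim_t`. -/
theorem codim_annihilator_pair_tmul {A C : Type*} [CommRing A] [Algebra K A] [CommRing C] [Algebra K C]
    [FiniteDimensional K A] [FiniteDimensional K C] (x x' : A) (y : C) :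
    Module.finrank K (A ⊗[K] C)
        - Module.finrank K ↥(LinearMap.ker (LinearMap.mulLeft K (x ⊗ₜ[K] y)) ⊓ LinearMap.ker (LinearMap.mulLeft K (x' ⊗ₜ[K] y)))
      = (Module.finrank K A - Module.finrank K ↥(LinearMap.ker (LinearMap.mulLeft K x) ⊓ LinearMap.ker (LinearMap.mulLeft K x')))
          * (Module.finrank K C - Module.finrank K ↥(LinearMap.ker (LinearMap.mulLeft K y))) := by
  rw [mulLeft_tmul, mulLeft_tmul, codim_ker_map_inf]

end Abstract

/-! ## PART B — (J1) with the computed level-`k₀` data equals THEOREM 1 (ii) for all `k` -/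

/-- One multiplication step: the coefficients of `q · (1 + X + X²)`. -/
theorem coeff_mul_one_add_X_add_X_sq (q : ℤ[X]) (n : ℕ) :
    (q * (1 + X + X ^ 2)).coeff n
      = q.coeff n + (if 1 ≤ n then q.coeff (n - 1) else 0) + (if 2 ≤ n then q.coeff (n - 2) else 0) := by
  have hX : (q * X).coeff n = if 1 ≤ n then q.coeff (n - 1) else 0 := by
    have h := coeff_mul_X_pow' q 1 n
    rw [pow_one] at h
    exact h
  rw [mul_add, mul_add, mul_one, coeff_add, coeff_add, hX, coeff_mul_X_pow']

/-- Closed forms of the five lowest coefficients of `(1 + X + X²)^j` (the Hilbert function of the Artinian Gorenstein algebra of a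
linear cycle in a quartic, `j` two-blocks), cleared of denominators. -/
theorem ci_quartic_low_coeffs (j : ℕ) :
    (((1 : ℤ[X]) + X + X ^ 2) ^ j).coeff 0 = 1 ∧
    (((1 : ℤ[X]) + X + X ^ 2) ^ j).coeff 1 = (j : ℤ) ∧
    2 * (((1 : ℤ[X]) + X + X ^ 2) ^ j).coeff 2 = (j : ℤ) * (j + 1) ∧
    6 * (((1 : ℤ[X]) + X + X ^ 2) ^ j).coeff 3 = (j : ℤ) * (j - 1) * (j + 4) ∧
    24 * (((1 : ℤ[X]) + X + X ^ 2) ^ j).coeff 4 = (j : ℤ) * (j - 1) * (j ^ 2 + 7 * j - 6) := by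
  induction j with
  | zero => simp [Polynomial.coeff_one]
  | succ j ih =>
      obtain ⟨h0, h1, h2, h3, h4⟩ := ih
      have step := coeff_mul_one_add_X_add_X_sq (((1 : ℤ[X]) + X + X ^ 2) ^ j)
      rw [pow_succ]
      refine ⟨?_, ?_, ?_, ?_, ?_⟩
      · rw [step 0]; simp [h0]
      · rw [step 1]; simp [h0, h1]
      · rw [step 2]; simp only [show (1:ℕ) ≤ 2 from by norm_num, le_refl, if_true, show 2 - 1 = 1 from rfl,
          show 2 - 2 = 0 from rfl, h1, h0]; push_cast; linear_combination h2
      · rw [step 3]; simp only [show (1:ℕ) ≤ 3 from by norm_num, show (2:ℕ) ≤ 3 from by norm_num, if_true,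
          show 3 - 1 = 2 from rfl, show 3 - 2 = 1 from rfl, h1]; push_cast; linear_combination h3 + 3 * h2
      · rw [step 4]; simp only [show (1:ℕ) ≤ 4 from by norm_num, show (2:ℕ) ≤ 4 from by norm_num, if_true,
          show 4 - 1 = 3 from rfl, show 4 - 2 = 2 from rfl]; push_cast; linear_combination h4 + 4 * h3 + 12 * h2

/-- (J2) for both families: the excess at the special value is `e_d(λ*; k) = 1 · [x^0](…)^j = 1` for every `k`. -/
theorem join_excess_coeff_zero (j : ℕ) :
    (((1 : ℤ[X]) + X + X ^ 2) ^ j).coeff 0 = 1 ∧ (((1 : ℤ[X]) + X) ^ j).coeff 0 = 1 := by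
  refine ⟨(ci_quartic_low_coeffs j).1, ?_⟩
  rw [add_comm, coeff_X_add_one_pow]; simp

/-- JOIN IDENTITY (J1), quartic family `[4,4,2^{k-4}]`, `k = j + 4`, level-`k₀` data `Hpair = (1, 6, 17, 30, 37)`:
`Σ_a Hpair(a)·[x^{4-a}](1+x+x²)^j = c_N(k, k-3, 4) = 2·C(k+3,4) - C(k+1,4) - [(k-2)(k+2) + 4k]` for EVERY `j` (all in `ℤ`). -/
theorem join_identity_quartic (j : ℕ) :
    37 * (((1 : ℤ[X]) + X + X ^ 2) ^ j).coeff 0 + 30 * (((1 : ℤ[X]) + X + X ^ 2) ^ j).coeff 1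
      + 17 * (((1 : ℤ[X]) + X + X ^ 2) ^ j).coeff 2 + 6 * (((1 : ℤ[X]) + X + X ^ 2) ^ j).coeff 3
      + (((1 : ℤ[X]) + X + X ^ 2) ^ j).coeff 4
    = 2 * (((j + 7).choose 4 : ℕ) : ℤ) - ((j + 5).choose 4 : ℕ) - (((j : ℤ) + 2) * (j + 6) + 4 * (j + 4)) := by
  obtain ⟨h0, h1, h2, h3, h4⟩ := ci_quartic_low_coeffs j
  have hA := twentyfour_mul_choose_four (j + 4)
  rw [show j + 4 + 3 = j + 7 by omega, show j + 4 + 2 = j + 6 by omega, show j + 4 + 1 = j + 5 by omega] at hA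
  have hB := twentyfour_mul_choose_four (j + 2)
  rw [show j + 2 + 3 = j + 5 by omega, show j + 2 + 2 = j + 4 by omega, show j + 2 + 1 = j + 3 by omega] at hB
  have hAz : (24 : ℤ) * ((j + 7).choose 4 : ℕ) = (j + 7) * (j + 6) * (j + 5) * (j + 4) := by exact_mod_cast hA
  have hBz : (24 : ℤ) * ((j + 5).choose 4 : ℕ) = (j + 5) * (j + 4) * (j + 3) * (j + 2) := by exact_mod_cast hB
  -- clear denominators: 24 · (both sides)
  have key : (24 : ℤ) * (37 * (((1 : ℤ[X]) + X + X ^ 2) ^ j).coeff 0 + 30 * (((1 : ℤ[X]) + X + X ^ 2) ^ j).coeff 1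
      + 17 * (((1 : ℤ[X]) + X + X ^ 2) ^ j).coeff 2 + 6 * (((1 : ℤ[X]) + X + X ^ 2) ^ j).coeff 3
      + (((1 : ℤ[X]) + X + X ^ 2) ^ j).coeff 4)
    = 24 * (2 * (((j + 7).choose 4 : ℕ) : ℤ) - ((j + 5).choose 4 : ℕ) - (((j : ℤ) + 2) * (j + 6) + 4 * (j + 4))) := by
    linear_combination (24 * 37) * h0 + (24 * 30) * h1 + (12 * 17) * h2 + 24 * h3 + h4 - 2 * hAz + hBz
  have h24 : (24 : ℤ) ≠ 0 := by norm_num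
  exact mul_left_cancel₀ h24 key

/-- The same in the census variable `k ≥ 4` (`j = k - 4`), right-hand side literally THEOREM 1 (ii)'s `c_N(k, k-3, 4)` as in
`HodgeLocusCensusFermatPointCodim`. -/
theorem join_identity_quartic_k (k : ℕ) (hk : 4 ≤ k) :
    37 * (((1 : ℤ[X]) + X + X ^ 2) ^ (k - 4)).coeff 0 + 30 * (((1 : ℤ[X]) + X + X ^ 2) ^ (k - 4)).coeff 1
      + 17 * (((1 : ℤ[X]) + X + X ^ 2) ^ (k - 4)).coeff 2 + 6 * (((1 : ℤ[X]) + X + X ^ 2) ^ (k - 4)).coeff 3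
      + (((1 : ℤ[X]) + X + X ^ 2) ^ (k - 4)).coeff 4
    = 2 * (((k + 3).choose 4 : ℕ) : ℤ) - ((k + 1).choose 4 : ℕ) - ((((k : ℕ) : ℤ) - 2) * (((k : ℕ) : ℤ) + 2) + 4 * ((k : ℕ) : ℤ)) := by
  obtain ⟨j, rfl⟩ : ∃ j, k = j + 4 := ⟨k - 4, by omega⟩
  rw [show j + 4 - 4 = j by omega, join_identity_quartic j,
    show j + 4 + 3 = j + 7 by omega, show j + 4 + 1 = j + 5 by omega]
  push_cast; ring

/-- JOIN IDENTITY (J1), cubic family `[4,4,4,2^{k-6}]`, `k = j + 6`, level-`k₀` data `Hpair = (1, 9, 27, 39)`, the CI Hilbert series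
`(1 + x)^j` (binomial coefficients): `39 + 27·j + 9·C(j,2) + C(j,3) = c_N(k, k-4, 3) = 2·C(k+2,3) - C(k-1,3) - [(k-3)(k+3) + 6k]`. -/
theorem join_identity_cubic (j : ℕ) :
    39 * ((j.choose 0 : ℕ) : ℤ) + 27 * ((j.choose 1 : ℕ) : ℤ) + 9 * ((j.choose 2 : ℕ) : ℤ) + ((j.choose 3 : ℕ) : ℤ)
    = 2 * (((j + 8).choose 3 : ℕ) : ℤ) - ((j + 5).choose 3 : ℕ) - (((j : ℤ) + 3) * (j + 9) + 6 * (j + 6)) := by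
  have hA := six_mul_choose_three (j + 6)
  rw [show j + 6 + 2 = j + 8 by omega, show j + 6 + 1 = j + 7 by omega] at hA
  have hB := six_mul_choose_three (j + 3)
  rw [show j + 3 + 2 = j + 5 by omega, show j + 3 + 1 = j + 4 by omega] at hB
  have hAz : (6 : ℤ) * ((j + 8).choose 3 : ℕ) = (j + 8) * (j + 7) * (j + 6) := by exact_mod_cast hA
  have hBz : (6 : ℤ) * ((j + 5).choose 3 : ℕ) = (j + 5) * (j + 4) * (j + 3) := by exact_mod_cast hB
  -- binomials of j: C(j,0) = 1, C(j,1) = j, 2 C(j,2) = j(j-1), 6 C(j,3) = j(j-1)(j-2)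
  have c0 : ((j.choose 0 : ℕ) : ℤ) = 1 := by simp
  have c1 : ((j.choose 1 : ℕ) : ℤ) = j := by simp
  have c2 : (2 : ℤ) * ((j.choose 2 : ℕ) : ℤ) = (j : ℤ) * (j - 1) := by
    rcases j with _ | n
    · simp
    · have h2z : (2 : ℤ) * (((n + 1).choose 2 : ℕ) : ℤ) = (n + 1) * n := by exact_mod_cast two_mul_choose_two n
      push_cast
      linear_combination h2z
  have c3 : (6 : ℤ) * ((j.choose 3 : ℕ) : ℤ) = (j : ℤ) * (j - 1) * (j - 2) := by
    rcases j with _ | _ | n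
    · simp
    · simp
    · have h3z : (6 : ℤ) * (((n + 2).choose 3 : ℕ) : ℤ) = (n + 2) * (n + 1) * n := by
        exact_mod_cast six_mul_choose_three n
      rw [show n + 1 + 1 = n + 2 from rfl]
      push_cast
      linear_combination h3z
  have key : (6 : ℤ) * (39 * ((j.choose 0 : ℕ) : ℤ) + 27 * ((j.choose 1 : ℕ) : ℤ) + 9 * ((j.choose 2 : ℕ) : ℤ) + ((j.choose 3 : ℕ) : ℤ))
      = 6 * (2 * (((j + 8).choose 3 : ℕ) : ℤ) - ((j + 5).choose 3 : ℕ) - (((j : ℤ) + 3) * (j + 9) + 6 * (j + 6))) := by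
    linear_combination (6 * 39) * c0 + (6 * 27) * c1 + 27 * c2 + c3 - 2 * hAz + hBz
  have h6 : (6 : ℤ) ≠ 0 := by norm_num
  exact mul_left_cancel₀ h6 key

/-- The cubic identity with the CI Hilbert series written as polynomial coefficients `[x^b](1 + x)^j` and in the census variable
`k ≥ 6`, right-hand side THEOREM 1 (ii)'s `c_N(k, k-4, 3) = 2·C(k+2,3) - C(k-1,3) - [(k-3)(2k-(k-4)-1) + 2k·3]`. -/
theorem join_identity_cubic_k (k : ℕ) (hk : 6 ≤ k) :
    39 * (((1 : ℤ[X]) + X) ^ (k - 6)).coeff 0 + 27 * (((1 : ℤ[X]) + X) ^ (k - 6)).coeff 1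
      + 9 * (((1 : ℤ[X]) + X) ^ (k - 6)).coeff 2 + (((1 : ℤ[X]) + X) ^ (k - 6)).coeff 3
    = 2 * (((k + 2).choose 3 : ℕ) : ℤ) - ((k - 1).choose 3 : ℕ)
      - ((((k : ℕ) : ℤ) - 3) * (2 * ((k : ℕ) : ℤ) - (((k : ℕ) : ℤ) - 4) - 1) + 2 * ((k : ℕ) : ℤ) * 3) := by
  obtain ⟨j, rfl⟩ : ∃ j, k = j + 6 := ⟨k - 6, by omega⟩
  have hc : ∀ b, (((1 : ℤ[X]) + X) ^ (j + 6 - 6)).coeff b = ((j.choose b : ℕ) : ℤ) := by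
    intro b; rw [show j + 6 - 6 = j by omega, add_comm, coeff_X_add_one_pow]
  rw [hc 0, hc 1, hc 2, hc 3, join_identity_cubic j, show j + 6 + 2 = j + 8 by omega, show j + 6 - 1 = j + 5 by omega]
  push_cast; ring

/-- Tabulated values (record §4 (i)): the right-hand sides for `k = 4..12` (quartic) and `k = 6..14` (cubic). -/
theorem join_values :
    (List.range 9).map (fun j : ℕ => 2 * (((j + 7).choose 4 : ℕ) : ℤ) - (((j + 5).choose 4 : ℕ) : ℤ)
        - (((j : ℤ) + 2) * (j + 6) + 4 * (j + 4)))
      = [37, 84, 161, 277, 442, 667, 964, 1346, 1827] ∧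
    (List.range 9).map (fun j : ℕ => 2 * (((j + 8).choose 3 : ℕ) : ℤ) - (((j + 5).choose 3 : ℕ) : ℤ)
        - (((j : ℤ) + 3) * (j + 9) + 6 * (j + 6)))
      = [39, 66, 102, 148, 205, 274, 356, 452, 563] := by
  constructor <;> decide

end Summit.HodgeConjecture.HodgeConjecture.HodgeLocus.Census.JoinIdentity
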